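import Summits.HodgeConjecture.HodgeConjecture.Theorems.CyclicUnitaryPowersFourFacts
import Literature.AlgebraicGeometry.HodgeTheory.CyclicCoverUniversalFamily

/-!
# Crux K1 `VeryGeneralDeckCommutatorsInHg` and the rung leaf modulo FOUR cited facts, the Carlson–Toledo
# family being CONSTRUCTED (route `CyclicUnitaryPowers`, items stmt-HodgeConjecture-19544 / 19543)

Prover seat `hodge-nonav-prover-Ax` (g4), cell `hodge-nonav`, 2026-08-28. Landed `--supports stmt-HodgeConjecture-19544`;
sorry-free, no definition, no new named fact here. CONDITIONAL results; nothing here says HC ∕ HC_AV is proved;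
rung F-H1 is not moved.

`CyclicUnitaryPowersFourFacts.veryGeneralDeckCommutatorsInHg_of_four_facts` closes K1 from
{`nonempty_carlsonToledoFamily`, `Griffiths1969_residueKernel_eq_jacobianIdeal`,
`carlsonToledo1999_unitaryReflection_zariskiDense`, `cmsp_nonHodgeGenericPoints_countable_algebraic_cover`}.
The first of these — the universal family of smooth cyclic covers of the plane WITH its Picard–Lefschetz
package — is now split (Literature `HodgeTheory/CyclicCoverUniversalFamily`): the family `cyclicCoverFamily p`
(base `Ũ` open in `ℂ^{N+1}`, smooth, irreducible, quasi-projective; quasi-projective total space; smooth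
projective family of surfaces; Ehresmann; classifying map with `exists_polynomials` and `pt_surjective`) is
CONSTRUCTED from the tree's universal hypersurface (`Motives/SpecialisedHypersurfaceFamily`, the sub-family
through the coefficient specialisation `a_{x₃^p} ↦ 1`, `a_{(e,0)} ↦ −b_e`), and only the Picard–Lefschetz CONTENT
(CT §3, §6 Prop., §7 last ¶, with the §2 identification of fibre and covering automorphism) remains cited, as
`carlsonToledo1999_cyclicReflectionSystem`; `nonempty_carlsonToledoFamily_of_cyclicReflectionSystem` recovers
the bundled fact. Hence:

* `veryGeneralDeckCommutatorsInHg_of_four_facts_PL` — **K1 ⟸ {`carlsonToledo1999_cyclicReflectionSystem`,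
  `Griffiths1969_residueKernel_eq_jacobianIdeal`, `carlsonToledo1999_unitaryReflection_zariskiDense`,
  `cmsp_nonHodgeGenericPoints_countable_algebraic_cover`}**;
* `cyclicSurfacePowersHodge_of_four_facts_PL` — the rung leaf likewise.

## References

* [CarlsonToledo1999] J. A. Carlson, D. Toledo, Duke Math. J. 97 (1999), §2, §3, §5, §6, Thm. 7.1.
* [VoisinHodgeII2003] C. Voisin, Hodge Theory and Complex Algebraic Geometry II (2003), §6.1.3 Thm. 6.10 / Cor. 6.12.
* [CattaniDeligneKaplan1995] E. Cattani, P. Deligne, A. Kaplan, J. Amer. Math. Soc. 8 (1995), Cor. 1.2.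
-/

noncomputable section

open Literature.AlgebraicGeometry.Motives Literature.AlgebraicGeometry.HodgeTheory

-- mandated namespace `Summit.HodgeConjecture.HodgeConjecture.Theorems` trips `linter.dupNamespace` (off tree-wide)
set_option linter.dupNamespace false

namespace Summit.HodgeConjecture.HodgeConjecture.Theorems.CyclicUnitaryPowersFourFactsPL

/-- **Crux K1 `VeryGeneralDeckCommutatorsInHg` modulo FOUR cited facts, with the Carlson–Toledo family
constructed**: the Picard–Lefschetz package of the family of cyclic covers (`carlsonToledo1999_cyclicReflectionSystem`,
CT §3, §6, §7), Griffiths' residue-kernel theorem (Voisin II Thm. 6.10), the Zariski density of the unitary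
reflection monodromy (CT Thm. 7.1) and the Cattani–Deligne–Kaplan cover. CONDITIONAL; nothing here says
HC ∕ HC_AV is proved. [cite: CarlsonToledo1999, §2, §3, §6 Proposition, §7 and Thm. 7.1]
[cite: VoisinHodgeII2003, §6.1.3 Thm. 6.10 and Cor. 6.12] -/
theorem veryGeneralDeckCommutatorsInHg_of_four_facts_PL
    (hPL : carlsonToledo1999_cyclicReflectionSystem)
    (hG : Griffiths1969_residueKernel_eq_jacobianIdeal)
    (hCT71 : carlsonToledo1999_unitaryReflection_zariskiDense)
    (hCDK : cmsp_nonHodgeGenericPoints_countable_algebraic_cover) :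
    Summit.HodgeConjecture.HodgeConjecture.Theses.CyclicUnitaryPowers.VeryGeneralDeckCommutatorsInHg :=
  CyclicUnitaryPowersFourFacts.veryGeneralDeckCommutatorsInHg_of_four_facts
    (nonempty_carlsonToledoFamily_of_cyclicReflectionSystem hPL) hG hCT71 @hCDK

/-- **The rung leaf `CyclicSurfacePowersHodge` modulo the same FOUR cited facts** (with the family constructed).
CONDITIONAL; rung F-H1 not moved. [cite: CarlsonToledo1999, §2, §3, §6 Proposition, §7 and Thm. 7.1]
[cite: VoisinHodgeII2003, §6.1.3 Thm. 6.10 and Cor. 6.12] -/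
theorem cyclicSurfacePowersHodge_of_four_facts_PL
    (hPL : carlsonToledo1999_cyclicReflectionSystem)
    (hG : Griffiths1969_residueKernel_eq_jacobianIdeal)
    (hCT71 : carlsonToledo1999_unitaryReflection_zariskiDense)
    (hCDK : cmsp_nonHodgeGenericPoints_countable_algebraic_cover) :
    Summit.HodgeConjecture.HodgeConjecture.Theses.CyclicUnitaryPowers.CyclicSurfacePowersHodge :=
  CyclicUnitaryPowersCyclicSurfacePowersHodge.cyclicSurfacePowersHodge_of_veryGeneralDeckCommutatorsInHg
    (veryGeneralDeckCommutatorsInHg_of_four_facts_PL @hPL @hG @hCT71 @hCDK)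

end Summit.HodgeConjecture.HodgeConjecture.Theorems.CyclicUnitaryPowersFourFactsPL

end
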